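import Literature.MathematicalPhysics.QuantumFieldTheory.Balaban1983to89.B16NodeKnitRecord5C

/-!
# `Balaban1983to89.B16NodeKnitRecordPinned` — YM-DAG node N13 · [Balaban1989LargeFieldII] CMP **122** (1989) 355–392, Theorem 1 p. 355 + (0.1), Cor. 3
# pp. 387 ∕ 391: VACUITY CENSUS AND REPAIR of the (R₅) slot of the Stage-5 knits (pub-ymgap referee dag-ref-D, flag F-n24T-1, READ #32, 2026-08-26):
# at NODE 00's Stage-5 records the residual 𝐑-carrier `θ.res.V` is read NEITHER by the datum NOR by admissibility, so every UNIVERSAL form of N13's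
# 𝐑-slot — «for all admissible parameters (of the datum)», «at every record world» — is UNSATISFIABLE (kernel facts below); the satisfiable form at ONE record
# is the PINNED one, equivalent to the world's own leaf `∀ P, (w.up P).rOperation`; the one-record knits of modules 5 ∕ 6 are re-issued on it (drop-in for
# seat dag-n24-a's `N24_at_record₅C_of_N13_exists` witness)

statement-level bookkeeping over published theorems with citation tags; kernel-checked compositions of tree theorems;
nothing here is a claim about the Yang–Mills mass gap.

CITATION HEADER (lean-in-tree rule).  Source: T. Bałaban, *Large field renormalization. II. Localization, exponentiation, and bounds for the
𝐑 operation*, Commun. Math. Phys. **122**, 355–392 (1989), doi:10.1007/bf01238433 [Balaban1989LargeFieldII] (cell paper B16 = «[V]»), with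
[Balaban1988Convergent] («[III]»: the ASSUMED 𝐑 of p. 244 — the leaf `DagBinding.ROpLeaf`; Cor. 3 (2.50) p. 264).  Seat `pub-ymgap-dag-n13-a` (YM-PLAN Track A,
HUMAN RULING D-0062: the KNIT-BY-NAME seat of node N13), module 9 of the seat.  BY NAME and UNCHANGED: `…Node00.Record5` ∕ `…Node00.Record5C` (seat
node00-def: `Stage5Params`, `Stage5Params.Admissible`, `densOfRecord₅`, `machineOfRecord₅`, `datumOfRecord₅`, `upOfRecord₅`, `upOfRecord₅C`, `IsRecordOfRecord₅`,
`IsRecordOfRecord₅C`), `…B16NodeKnitRecord5` (module 5: `b16_main_at_stage5Params_of_cor3Leaves`), `…B16NodeKnitRecord5C` (module 6: `rOperation_iff_rOpLeaf_res₅C`,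
`b16_main_at_stage5ParamsC_of_cor3Leaves`), `…B16NodeKnit` (module 1: `uvSlot_of_cor3Leaves`), `…DagBinding` (`PrintedCarriers14R`, `ROpLeaf`, `rOpLeaf_iff`,
`leavesP`, `WorldP`), `…B14Cor3` (the five leaves `LeafH ∕ U1 ∕ U2 ∕ L1 ∕ L2`, `ReprFamily`).  §1 is ADAPTED FROM referee dag-ref-D's kernel probe
`pub-ymgap-dag-ref-D/READS/refD_hR_unsat.lean` (`datumOfRecord₅_modV`, `hR_unsat`, `hR_unsat₅`, `hR_pinned_iff`), credited decl by decl.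

WHY THIS FILE.  Modules 5 ∕ 6 (`B16NodeKnitRecord5 ∕ 5C`) and module 7 §3 (`B16NodeKnitSocket`) display N13's 𝐑-product over Stage-5 records in three forms:
(a) `∀ θ, θ.Admissible → ∀ P, ROpLeaf (θ.res.V P)` (the `…_forall_…_of_cor3Leaves` ∕ `s_N13E_*_of_slots₅(C)` shapes; Socket §3 `rOperation_of_isRecordOfRecord₅C`,
`s_N13E_threshold_shape_of_*₅C_at_datum`); (b) `∀ θ, θ.Admissible → D = datumOfRecord₅ θ → ∀ P, ROpLeaf (θ.res.V P)` (`b16_main_reExp_of_isRecordOfRecord₅C ∕ ₅`,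
consumed by seat dag-n24-a's `N24GlueThreshold.N24_at_record₅C_knit₁₃` and `N24KnitStage5`); (c) `∀ D w, IsRecordOfRecord₅C D w → ∀ P, (w.up P).rOperation`
(Socket §2 at `Rec := ₅C`).  Referee dag-ref-D (F-n24T-1) certified that (b) is UNSATISFIABLE at every record: the Stage-5 DATUM reads no residual carrier and
`Stage5Params.Admissible` reads no residual, so the `∀ θ` ranges over parameters with an ARBITRARY 𝐑-carrier, and a carrier with `K = 1`, `Scorr ≡ ⊤`, `S ≡ ⊥`
fails `ROpLeaf`.  The same swap kills (a) (given one admissible parameter) and (c) (given one record: re-bind its world to the swapped parameters).  This is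
the Stage-5 scoping fact «carriers residual ⇒ children junk-refutable» (seat node00-def `STAGE5-SCOPING-g28.md` §1) striking the 𝐑-slot: NO universal form
of N13's 𝐑-product is satisfiable before a stage PINS `V` (Stage ₉C: the represented tower, module 8 `B16NodeKnitRepTower` §2 supplies the pin reading).  What
IS satisfiable at Stage 5 is the 𝐑-slot AT ONE RECORD in pinned form — `∀ θ, θ.Admissible → D = datumOfRecord₅ θ → (∀ P, w.up P = upOfRecord₅C θ P) → ∀ P,
ROpLeaf (θ.res.V P)` — which is PRECISELY the world's own leaf `∀ P, (w.up P).rOperation` (§1, dag-ref-D's exact repair); §2 re-issues the one-record knits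
on it.  The theorems of modules 5–7 with slots (a)–(c) remain correct implications and stay (importers use them); this file records, in kernel form, that
their 𝐑-slot cannot be discharged at Stage 5 and names the replacement.

WHAT THIS FILE PROVES (0 `sorry`, 0 `def`, standard axioms).
§1 Census (kernel facts): `densOfRecord₅_updV` ∕ `machineOfRecord₅_updV` ∕ **`datumOfRecord₅_updV`** (the Stage-5 tower ∕ machine ∕ datum are blind to
   `res.V`); `admissible_updV`; `not_rOpLeaf_emptyTarget` (a carrier with `K = 1`, `Scorr ≡ ⊤`, `S ≡ ⊥` fails the leaf); **`not_forall_admissible_rOpLeaf`**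
   (form (a) is false given one admissible parameter); **`not_forall_atDatum_rOpLeaf₅C ∕ ₅`** (form (b) is false at every record — dag-ref-D's `hR_unsat ∕
   hR_unsat₅`); `isRecordOfRecord₅C_updV ∕ ₅` (re-binding a record world to the swapped parameters is again a record over the SAME datum);
   **`not_forall_record_rOperation₅C ∕ ₅`** (form (c) is false given one record); **`forall_pinned_rOpLeaf_iff_rOperation₅C ∕ ₅`** (the pinned form ↔ the
   world's leaf — dag-ref-D's `hR_pinned_iff`).
§2 Repaired one-record knits, (R) := the world's leaf: **`b16_main_reExp_of_isRecordOfRecord₅C_pinned`** (drop-in for module 6's `…reExp…₅C` in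
   `N24_at_record₅C_of_N13_exists`'s witness), `b16_main_reExp_of_isRecordOfRecord₅_pinned` (₅ twin, for `N24KnitStage5`), `b16_main_of_isRecordOfRecord₅C_of_leaf`
   ∕ `…₅_of_leaf` (the un-re-lettered one-record knits with (R) := the leaf and (UV₅) := the five Cor.-3 leaves at `D.C`).

HONEST FRAMING.  A count-neutral landing (R429 (4)(i)): bookkeeping census + repair; N13 is NOT discharged; at Stage 5 its 𝐑-product is the world's leaf as a
HYPOTHESIS (dischargeable only once `V` is pinned, Stage ₉C); nothing of Bałaban's asserted or proved here; one finite four-torus programme at fixed `ε`,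
Bałaban AS PRINTED with locators; nothing continuum ∕ ℝ⁴ ∕ OS ∕ mass gap ∕ Clay.
-/

noncomputable section

namespace Literature.MathematicalPhysics.QuantumFieldTheory.Balaban1983to89.B16NodeKnitRecordPinned

open DagBinding T4DatumAssembly T4Continuum Node00 FlowStepRuns
open B16NodeKnitRecord5C (rOperation_iff_rOpLeaf_res₅C b16_main_at_stage5ParamsC_of_cor3Leaves)
open B16NodeKnitRecord5 (b16_main_at_stage5Params_of_cor3Leaves)

variable {F : T4Family} {N : ℕ} [NeZero N]

/-! ## §1. Census: the Stage-5 datum and admissibility are blind to the residual 𝐑-carrier `θ.res.V` -/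

section Census

/-- The Stage-5 density tower does not read the residual 𝐑-carrier: swapping `θ.res.V` for any `V'` leaves `densOfRecord₅ θ p k` unchanged (induction on
`k`; each step reads `res.E`, `res.R` only).  Adapted from referee dag-ref-D's probe (`densOfRecord₅_modV`). [cite: Balaban1988Convergent, (0.2) p.244 (bookkeeping: the tower reads `E`, `R`, not the p.244 carrier)] -/
theorem densOfRecord₅_updV (θ : Stage5Params F N) (V' : B12.RunParams → PrintedCarriers14R) (p : B12.RunParams) :
    ∀ k, densOfRecord₅ F N { θ with res := { θ.res with V := V' } } p k = densOfRecord₅ F N θ p k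
  | 0 => rfl
  | k + 1 => by
    show θ.res.R p k (TrhoOfRecord F N p.K k (densOfRecord₅ F N { θ with res := { θ.res with V := V' } } p k)) =
      θ.res.R p k (TrhoOfRecord F N p.K k (densOfRecord₅ F N θ p k))
    rw [densOfRecord₅_updV θ V' p k]

/-- Nor does the RG machine of the record (every field reads `res.βfun ∕ E ∕ dom ∕ effAction ∕ wilsonBG ∕ Ek ∕ χ ∕ S218 ∕ ReprA ∕ IndA ∕ R` — never `V`).
Adapted from dag-ref-D's probe (`machineOfRecord₅_modV`). [cite: Balaban1987RG1, (0.22)–(0.24) p.256 (bookkeeping: the machine's dictionary)] -/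
theorem machineOfRecord₅_updV (θ : Stage5Params F N) (V' : B12.RunParams → PrintedCarriers14R) :
    machineOfRecord₅ F N { θ with res := { θ.res with V := V' } } = machineOfRecord₅ F N θ := by
  have hd : ∀ p k, densOfRecord₅ F N { θ with res := { θ.res with V := V' } } p k = densOfRecord₅ F N θ p k :=
    fun p k => densOfRecord₅_updV θ V' p k
  unfold machineOfRecord₅
  simp only [hd]

/-- **The Stage-5 DATUM is blind to the residual 𝐑-carrier**: `datumOfRecord₅ {θ with V := V'} = datumOfRecord₅ θ`.  Adapted from dag-ref-D's probe
(`datumOfRecord₅_modV`). [cite: Balaban1988Convergent, (0.2) p.244 and p.244 (the assumed 𝐑 is not an object of the datum; bookkeeping)] -/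
theorem datumOfRecord₅_updV (θ : Stage5Params F N) (V' : B12.RunParams → PrintedCarriers14R) :
    datumOfRecord₅ F N { θ with res := { θ.res with V := V' } } = datumOfRecord₅ F N θ := by
  unfold datumOfRecord₅
  rw [machineOfRecord₅_updV]

/-- Nor does admissibility read it (`Stage5Params.Admissible` = Stage-1 admissibility ∧ `0 < γ`). [cite: Balaban1989LargeFieldII, Thm 1 p.355 (bookkeeping: the parameter dictionary)] -/
theorem admissible_updV {θ : Stage5Params F N} (hθ : θ.Admissible) (V' : B12.RunParams → PrintedCarriers14R) :
    ({ θ with res := { θ.res with V := V' } } : Stage5Params F N).Admissible :=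
  hθ

/-- **A carrier failing the leaf**: on any carrier's lattice data, `K := 1`, the corresponding space `Scorr :≡ ⊤` and the target space `S :≡ ⊥` refute
`ROpLeaf` (the zero density lies in `Scorr 1` and its `R`-image does not lie in `S 1`).  Adapted from dag-ref-D's probe (`not_rOpLeaf_badCarrier`).
[cite: Balaban1988Convergent, p.244 (the assumed property of 𝐑, as the leaf types it; bookkeeping)] -/
theorem not_rOpLeaf_emptyTarget (V₀ : PrintedCarriers14R) :
    ¬ ROpLeaf { V₀ with K := 1, Scorr := fun _ _ => True, S := fun _ _ => False } := fun h =>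
  (rOpLeaf_iff _).1 h 0 Nat.one_pos (fun _ => 0) trivial

/-- **Form (a) is unsatisfiable**: given ONE admissible Stage-5 parameter, «[III] p. 244's property holds for the residual 𝐑-carrier of EVERY admissible
parameter at every run» is FALSE (swap the carrier for the empty-target one; admissibility does not notice).  Census of the (R₅) slot of
`B16NodeKnitRecord5(C).b16_main_forall_isRecordOfRecord₅(C)_of_cor3Leaves`, `s_N13E_shape_of_slots₅(C)(_gamma)`, `s_N13E_threshold_shape_of_slots₅C`, and
`B16NodeKnitSocket.rOperation_of_isRecordOfRecord₅C` ∕ `s_N13E_threshold_shape_of_direct₅C_at_datum` ∕ `…dominated₅C_at_datum`: correct implications with an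
undischargeable hypothesis at Stage 5. [cite: Balaban1988Convergent, p.244 (bookkeeping: the carrier is residual at Stage 5)] -/
theorem not_forall_admissible_rOpLeaf (θ₀ : Stage5Params F N) (h₀ : θ₀.Admissible) :
    ¬ ∀ θ : Stage5Params F N, θ.Admissible → ∀ P : B12.RunParams, ROpLeaf (θ.res.V P) := fun h =>
  not_rOpLeaf_emptyTarget (θ₀.res.V ⟨0, F.m, 1⟩)
    (h { θ₀ with res := { θ₀.res with V := fun P => { θ₀.res.V P with K := 1, Scorr := fun _ _ => True, S := fun _ _ => False } } }
      (admissible_updV h₀ _) ⟨0, F.m, 1⟩)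

variable {D : FiniteEpsData F (SU N)} {w : WorldP}

/-- **Form (b) is unsatisfiable at every `₅C` record** (referee dag-ref-D, F-n24T-1, `hR_unsat`): the slot `∀ θ, θ.Admissible → D = datumOfRecord₅ θ → ∀ P,
ROpLeaf (θ.res.V P)` of module 6's `b16_main_reExp_of_isRecordOfRecord₅C` (consumed by `N24GlueThreshold.N24_at_record₅C_knit₁₃`) is FALSE whenever `(D, w)` is a
record — the datum clause does not pin the carrier (`datumOfRecord₅_updV`). [cite: Balaban1988Convergent, p.244 (bookkeeping)] -/
theorem not_forall_atDatum_rOpLeaf₅C (h : IsRecordOfRecord₅C F N D w) :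
    ¬ ∀ θ : Stage5Params F N, θ.Admissible → D = datumOfRecord₅ F N θ → ∀ P : B12.RunParams, ROpLeaf (θ.res.V P) := by
  intro hR
  obtain ⟨θ, hθ, hD, -, -, -, -⟩ := h
  refine not_rOpLeaf_emptyTarget (θ.res.V ⟨0, F.m, 1⟩)
    (hR { θ with res := { θ.res with V := fun P => { θ.res.V P with K := 1, Scorr := fun _ _ => True, S := fun _ _ => False } } }
      (admissible_updV hθ _) ?_ ⟨0, F.m, 1⟩)
  rw [datumOfRecord₅_updV]
  exact hD

/-- **Form (b) is unsatisfiable at every `₅` record** (dag-ref-D `hR_unsat₅`; the slot of module 5's `b16_main_reExp_of_isRecordOfRecord₅`, consumed by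
`N24KnitStage5`). [cite: Balaban1988Convergent, p.244 (bookkeeping)] -/
theorem not_forall_atDatum_rOpLeaf₅ (h : IsRecordOfRecord₅ F N D w) :
    ¬ ∀ θ : Stage5Params F N, θ.Admissible → D = datumOfRecord₅ F N θ → ∀ P : B12.RunParams, ROpLeaf (θ.res.V P) := by
  intro hR
  obtain ⟨θ, hθ, hD, -, -, -, -⟩ := h
  refine not_rOpLeaf_emptyTarget (θ.res.V ⟨0, F.m, 1⟩)
    (hR { θ with res := { θ.res with V := fun P => { θ.res.V P with K := 1, Scorr := fun _ _ => True, S := fun _ _ => False } } }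
      (admissible_updV hθ _) ?_ ⟨0, F.m, 1⟩)
  rw [datumOfRecord₅_updV]
  exact hD

/-- Re-binding a `₅C` record's world to the carrier-swapped parameters is again a `₅C` record over the SAME datum (the datum, the construction, `γ`, `L` are
blind to `V`; the up-clause holds by construction). [cite: Balaban1989LargeFieldII, Thm 1 p.355 (bookkeeping: the record predicate)] -/
theorem isRecordOfRecord₅C_updV (h : IsRecordOfRecord₅C F N D w) :
    ∃ θ : Stage5Params F N, θ.Admissible ∧ D = datumOfRecord₅ F N θ ∧ (∀ P, w.up P = upOfRecord₅C F N θ P) ∧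
      ∀ V' : B12.RunParams → PrintedCarriers14R,
        IsRecordOfRecord₅C F N D { w with up := fun P => upOfRecord₅C F N { θ with res := { θ.res with V := V' } } P } := by
  obtain ⟨θ, hθ, hD, hC, hγ, hL, hup⟩ := h
  refine ⟨θ, hθ, hD, hup, fun V' => ⟨{ θ with res := { θ.res with V := V' } }, admissible_updV hθ V', ?_, hC, hγ, hL, fun _ => rfl⟩⟩
  rw [datumOfRecord₅_updV]
  exact hD

/-- The `₅` twin of `isRecordOfRecord₅C_updV`. [cite: Balaban1989LargeFieldII, Thm 1 p.355 (bookkeeping)] -/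
theorem isRecordOfRecord₅_updV (h : IsRecordOfRecord₅ F N D w) :
    ∃ θ : Stage5Params F N, θ.Admissible ∧ D = datumOfRecord₅ F N θ ∧ (∀ P, w.up P = upOfRecord₅ F N θ P) ∧
      ∀ V' : B12.RunParams → PrintedCarriers14R,
        IsRecordOfRecord₅ F N D { w with up := fun P => upOfRecord₅ F N { θ with res := { θ.res with V := V' } } P } := by
  obtain ⟨θ, hθ, hD, hC, hγ, hL, hup⟩ := h
  refine ⟨θ, hθ, hD, hup, fun V' => ⟨{ θ with res := { θ.res with V := V' } }, admissible_updV hθ V', ?_, hC, hγ, hL, fun _ => rfl⟩⟩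
  rw [datumOfRecord₅_updV]
  exact hD

/-- **Form (c) is unsatisfiable**: given ONE `₅C` record, «the 𝐑-leaf holds at every run of EVERY `₅C` record world» is FALSE (re-bind the record's world to
the empty-target carrier: again a record, whose leaf fails).  Census of module 7 §2's (R) hypothesis `∀ D w, Rec D w → ∀ P, (w.up P).rOperation` AT
`Rec := IsRecordOfRecord₅C` (hence of `s_N13E_threshold_shape_of_direct ∕ _dominated` there): satisfiable only over a record predicate that PINS `V`.
[cite: Balaban1988Convergent, p.244; Balaban1989LargeFieldII, Thm 1 p.355 (bookkeeping: Stage-5 scoping of the 𝐑-slot)] -/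
theorem not_forall_record_rOperation₅C (h : IsRecordOfRecord₅C F N D w) :
    ¬ ∀ (D' : FiniteEpsData F (SU N)) (w' : WorldP), IsRecordOfRecord₅C F N D' w' → ∀ P : B12.RunParams, (w'.up P).rOperation := by
  intro hR
  obtain ⟨θ, -, -, -, hrec⟩ := isRecordOfRecord₅C_updV h
  exact not_rOpLeaf_emptyTarget (θ.res.V ⟨0, F.m, 1⟩)
    (hR D _ (hrec fun P => { θ.res.V P with K := 1, Scorr := fun _ _ => True, S := fun _ _ => False }) ⟨0, F.m, 1⟩)

/-- **Form (c) is unsatisfiable, `₅` twin** (the N-binding `upOfRecord₅`). [cite: Balaban1988Convergent, p.244 (bookkeeping)] -/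
theorem not_forall_record_rOperation₅ (h : IsRecordOfRecord₅ F N D w) :
    ¬ ∀ (D' : FiniteEpsData F (SU N)) (w' : WorldP), IsRecordOfRecord₅ F N D' w' → ∀ P : B12.RunParams, (w'.up P).rOperation := by
  intro hR
  obtain ⟨θ, -, -, -, hrec⟩ := isRecordOfRecord₅_updV h
  exact not_rOpLeaf_emptyTarget (θ.res.V ⟨0, F.m, 1⟩)
    (hR D _ (hrec fun P => { θ.res.V P with K := 1, Scorr := fun _ _ => True, S := fun _ _ => False }) ⟨0, F.m, 1⟩)

/-- **THE SATISFIABLE FORM — dag-ref-D's exact repair (`hR_pinned_iff`)**: at a `₅C` record, the 𝐑-slot «for the parameters of the datum THAT BIND THE WORLD»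
(`∀ θ, θ.Admissible → D = datumOfRecord₅ θ → (∀ P, w.up P = upOfRecord₅C θ P) → ∀ P, ROpLeaf (θ.res.V P)` — the pin clause module 6's `slots` at :113 ∕ :130 already
carries) is PRECISELY the world's own leaf `∀ P, (w.up P).rOperation` ([III] p. 244's property bound at the world's upstream block), like every other leaf consumed
through `leavesP w P`. [cite: Balaban1988Convergent, p.244 (bookkeeping)] -/
theorem forall_pinned_rOpLeaf_iff_rOperation₅C (h : IsRecordOfRecord₅C F N D w) :
    (∀ θ : Stage5Params F N, θ.Admissible → D = datumOfRecord₅ F N θ → (∀ P, w.up P = upOfRecord₅C F N θ P) →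
        ∀ P : B12.RunParams, ROpLeaf (θ.res.V P)) ↔
      ∀ P : B12.RunParams, (w.up P).rOperation := by
  refine ⟨fun hR P => ?_, fun hw θ' _ _ hup' P => (rOperation_iff_rOpLeaf_res₅C F N θ' w P (hup' P)).1 (hw P)⟩
  obtain ⟨θ, hθ, hD, -, -, -, hup⟩ := h
  exact (rOperation_iff_rOpLeaf_res₅C F N θ w P (hup P)).2 (hR θ hθ hD hup P)

/-- The `₅` twin of `forall_pinned_rOpLeaf_iff_rOperation₅C` (N-binding `upOfRecord₅`, whose `rOperation` leaf is `ROpLeaf (θ.res.V P)` definitionally).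
[cite: Balaban1988Convergent, p.244 (bookkeeping)] -/
theorem forall_pinned_rOpLeaf_iff_rOperation₅ (h : IsRecordOfRecord₅ F N D w) :
    (∀ θ : Stage5Params F N, θ.Admissible → D = datumOfRecord₅ F N θ → (∀ P, w.up P = upOfRecord₅ F N θ P) →
        ∀ P : B12.RunParams, ROpLeaf (θ.res.V P)) ↔
      ∀ P : B12.RunParams, (w.up P).rOperation := by
  refine ⟨fun hR P => ?_, fun hw θ' _ _ hup' P => ?_⟩
  · obtain ⟨θ, hθ, hD, -, -, -, hup⟩ := h
    have h1 : (upOfRecord₅ F N θ P).rOperation := hR θ hθ hD hup P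
    rw [← hup P] at h1
    exact h1
  · have h1 := hw P
    rw [hup' P] at h1
    exact h1

end Census

/-! ## §2. The one-record knits re-issued on the world's leaf (drop-in replacements) -/

section Repair

variable {D : FiniteEpsData F (SU N)} {w : WorldP}

/-- **N13 AT THE RE-LETTERED `₅C` RECORD WORLD, (R) := THE WORLD'S LEAF** — drop-in replacement of module 6's `b16_main_reExp_of_isRecordOfRecord₅C` (whose
(R₅) slot is form (b), unsatisfiable: `not_forall_atDatum_rOpLeaf₅C`): from datum-indexed exponent families `eM eP`, the 𝐑-leaf at every run of THIS world
(`hR : ∀ P, (w.up P).rOperation` — [Balaban1989LargeFieldII] Thm 1 for 𝐑, a HYPOTHESIS dischargeable once the carrier is pinned), and [III] p. 264's five leaves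
of a representation family of `(datumOfRecord₅ θ).C` at `(w.γ, eM D, eP D)` for the parameters of the datum (θ-independent content: all such θ share `D.C`), N13
at every run of `{w with em := eM D, ep := eP D}`.  Plugs into seat dag-n24-a's `N24GlueThreshold.N24_at_record₅C_of_N13_exists` witness
`⟨eM D, eP D, b16_main_reExp_of_isRecordOfRecord₅C_pinned eM eP h hR hcor⟩`. [cite: Balaban1989LargeFieldII, Thm 1 p.355, p.387, p.391; Balaban1988Convergent, p.244, Cor. 3 (2.50) p.264] -/
theorem b16_main_reExp_of_isRecordOfRecord₅C_pinned (eM eP : FiniteEpsData F (SU N) → ℝ → ℝ) (h : IsRecordOfRecord₅C F N D w)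
    (hR : ∀ P : B12.RunParams, (w.up P).rOperation)
    (hcor : ∀ θ : Stage5Params F N, θ.Admissible → D = datumOfRecord₅ F N θ →
      ∃ R : B14Cor3.ReprFamily (datumOfRecord₅ F N θ).C,
        B14Cor3.LeafH (datumOfRecord₅ F N θ).C R w.γ ∧ B14Cor3.LeafU1 (datumOfRecord₅ F N θ).C R w.γ ∧
        B14Cor3.LeafU2 (datumOfRecord₅ F N θ).C R w.γ (eP D) ∧ B14Cor3.LeafL1 (datumOfRecord₅ F N θ).C R w.γ ∧
        B14Cor3.LeafL2 (datumOfRecord₅ F N θ).C R w.γ (eM D)) :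
    ∀ P : B12.RunParams, Dag.B16_main (leavesP { w with em := eM D, ep := eP D } P) := by
  intro P
  obtain ⟨θ, hθ, hD, hC, -, -, hup⟩ := h
  obtain ⟨R, hH, hU1, hU2, hL1, hL2⟩ := hcor θ hθ hD
  have hR' : ROpLeaf (θ.res.V P) := (rOperation_iff_rOpLeaf_res₅C F N θ w P (hup P)).1 (hR P)
  exact b16_main_at_stage5ParamsC_of_cor3Leaves F N θ { w with em := eM D, ep := eP D } P (by rw [← hD]; exact hC) (hup P)
    hR' R hH hU1 hU2 hL1 hL2

/-- **The `₅` twin** — drop-in replacement of module 5's `b16_main_reExp_of_isRecordOfRecord₅` (form (b), unsatisfiable: `not_forall_atDatum_rOpLeaf₅`) for seat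
dag-n24-a's `N24KnitStage5` consumers, (R) := the world's leaf. [cite: Balaban1989LargeFieldII, Thm 1 p.355, p.387, p.391; Balaban1988Convergent, p.244, Cor. 3 (2.50) p.264] -/
theorem b16_main_reExp_of_isRecordOfRecord₅_pinned (eM eP : FiniteEpsData F (SU N) → ℝ → ℝ) (h : IsRecordOfRecord₅ F N D w)
    (hR : ∀ P : B12.RunParams, (w.up P).rOperation)
    (hcor : ∀ θ : Stage5Params F N, θ.Admissible → D = datumOfRecord₅ F N θ →
      ∃ R : B14Cor3.ReprFamily (datumOfRecord₅ F N θ).C,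
        B14Cor3.LeafH (datumOfRecord₅ F N θ).C R w.γ ∧ B14Cor3.LeafU1 (datumOfRecord₅ F N θ).C R w.γ ∧
        B14Cor3.LeafU2 (datumOfRecord₅ F N θ).C R w.γ (eP D) ∧ B14Cor3.LeafL1 (datumOfRecord₅ F N θ).C R w.γ ∧
        B14Cor3.LeafL2 (datumOfRecord₅ F N θ).C R w.γ (eM D)) :
    ∀ P : B12.RunParams, Dag.B16_main (leavesP { w with em := eM D, ep := eP D } P) := by
  intro P
  obtain ⟨θ, hθ, hD, hC, -, -, hup⟩ := h
  obtain ⟨R, hH, hU1, hU2, hL1, hL2⟩ := hcor θ hθ hD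
  have hR' : ROpLeaf (θ.res.V P) := by
    have h1 := hR P
    rw [hup P] at h1
    exact h1
  exact b16_main_at_stage5Params_of_cor3Leaves F N θ { w with em := eM D, ep := eP D } P (by rw [← hD]; exact hC) (hup P)
    hR' R hH hU1 hU2 hL1 hL2

/-- **N13 at one `₅C` record world, (R) := the leaf, (UV₅) := the five Cor.-3 leaves at the datum's construction** with the world's own letters `(w.γ, w.em,
w.ep)` — the un-re-lettered companion of `b16_main_reExp_of_isRecordOfRecord₅C_pinned` (module 6's `b16_main_of_isRecordOfRecord₅C_of_cor3Leaves` already carries the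
pin clause; this form drops `θ` from the 𝐑-slot altogether). [cite: Balaban1989LargeFieldII, Thm 1 p.355, p.387; Balaban1988Convergent, p.244, Cor. 3 (2.50) p.264] -/
theorem b16_main_of_isRecordOfRecord₅C_of_leaf (h : IsRecordOfRecord₅C F N D w) (hR : ∀ P : B12.RunParams, (w.up P).rOperation)
    (R : B14Cor3.ReprFamily D.C) (hH : B14Cor3.LeafH D.C R w.γ) (hU1 : B14Cor3.LeafU1 D.C R w.γ) (hU2 : B14Cor3.LeafU2 D.C R w.γ w.ep)
    (hL1 : B14Cor3.LeafL1 D.C R w.γ) (hL2 : B14Cor3.LeafL2 D.C R w.γ w.em) :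
    ∀ P : B12.RunParams, Dag.B16_main (leavesP w P) := by
  intro P
  refine B16NodeKnitRecord5.b16_main_of_rOperation_of_uvSlot w P (hR P) ?_
  obtain ⟨C, γ, em, ep, βup, β₀, β₀_pos, b, b_pos, L, one_lt_L, gR, up⟩ := w
  cases construction_eq_of_isRecordOfRecord₅C h
  exact B16NodeKnit.uvSlot_of_cor3Leaves _ R hH hU1 hU2 hL1 hL2 P

/-- The `₅` twin of `b16_main_of_isRecordOfRecord₅C_of_leaf`. [cite: Balaban1989LargeFieldII, Thm 1 p.355, p.387; Balaban1988Convergent, p.244, Cor. 3 (2.50) p.264] -/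
theorem b16_main_of_isRecordOfRecord₅_of_leaf (h : IsRecordOfRecord₅ F N D w) (hR : ∀ P : B12.RunParams, (w.up P).rOperation)
    (R : B14Cor3.ReprFamily D.C) (hH : B14Cor3.LeafH D.C R w.γ) (hU1 : B14Cor3.LeafU1 D.C R w.γ) (hU2 : B14Cor3.LeafU2 D.C R w.γ w.ep)
    (hL1 : B14Cor3.LeafL1 D.C R w.γ) (hL2 : B14Cor3.LeafL2 D.C R w.γ w.em) :
    ∀ P : B12.RunParams, Dag.B16_main (leavesP w P) := by
  intro P
  refine B16NodeKnitRecord5.b16_main_of_rOperation_of_uvSlot w P (hR P) ?_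
  obtain ⟨C, γ, em, ep, βup, β₀, β₀_pos, b, b_pos, L, one_lt_L, gR, up⟩ := w
  obtain ⟨θ, -, -, hC, -⟩ := h
  cases hC
  exact B16NodeKnit.uvSlot_of_cor3Leaves _ R hH hU1 hU2 hL1 hL2 P

end Repair

end Literature.MathematicalPhysics.QuantumFieldTheory.Balaban1983to89.B16NodeKnitRecordPinned

end
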